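import Summits.ResolutionOfSingularities.ResolutionOfSingularities.Theorems.HilbertSamuelEliminationSigmaMaxModificationsCorridor3SigmaMenuSurfacePointStep
import Summits.ResolutionOfSingularities.ResolutionOfSingularities.Theorems.HilbertSamuelEliminationSigmaMaxModificationsCorridor3SigmaPointCompositionIso
import Summits.ResolutionOfSingularities.ResolutionOfSingularities.Theorems.HilbertSamuelEliminationSigmaMaxModificationsCorridor3SigmaSurfaceStrictTransform
import Summits.ResolutionOfSingularities.ResolutionOfSingularities.Theorems.HilbertSamuelEliminationSigmaMaxModificationsCorridor3SigmaMenuSchedulerFair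
import Literature.AlgebraicGeometry.Resolution.TransformContainmentOffCentre
import Literature.AlgebraicGeometry.Resolution.PrincipalStrictTransform
import Literature.AlgebraicGeometry.Resolution.IdealSheafDescent
import HarnessLib

/-!
# [OURS · L1 W4.2] σ-LAYER PHASE B′ — `Corridor3SigmaMenuSurfacePointStepNext`: the filtered trace configuration AFTER A POINT STEP is the TOTAL TRANSFORM of
# the configuration — `S(E′, D′) = ρ⁻¹ S(E, D)` read on the blow-up `ρ : D̃′ → D̃` of the surface at the centre `q ∈ S(E, D)` — for EVERY boundary transform with
# the support sandwich (the run's `Boundary.next` = saturated strict transforms + exceptional divisor; CJS's `completeTransformList` = principal strict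
# transforms + exceptional divisor), and the RUN-LEVEL ℓ-DROP: **`surfaceSncLength (E.next C) (surfaceNext (blowup.π C) C D) < surfaceSncLength E D`** whenever
# the F-75 point step proposed `C` for the surface component `D`
# (CHAIN w42 v3.22 §0u «remaining W-side identification π₁⁻¹S(E,D) = S(E′,D′)»; res-L1-w42-plan-1 RULING v3.14-36 (IC), CRUX-PLAN v3.13b/c (4) PHASE B′ `lex(ℓ, M)`;
# crux chain w42 `SigmaMaxModifications` stmt-ResolutionOfSingularities-18506 / conjunct `SigmaMaxModificationsCorridor3` stmt-ResolutionOfSingularities-19249;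
# helper of res-L1-w42-stub-1 (gen 5), `--supports stmt-…-19249 --as helper`, counted 0)

HONEST FRAMING. OURS bookkeeping over: res-type-067's carrier glue `…SigmaSurfaceStrictTransform` (p542701: `surfaceNext`, the comparison square
`hπ.strictTransformHom hρ ≫ π = ρ ≫ ι`, `exists_iso_menuCentre_surfaceNext`, `Boundary.restrictOff_map_comap`) and LAYER 1/2 (`Boundary.divisorSet`,
`Boundary.restrictOff`); res-L1-type-o1's `Boundary.next` (`…SigmaBoundaryDefs`), `Sigma.mem_support_strictTransformIdeal_iff_of_not_mem` (`…SigmaMenuSchedulerFair`)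
and Literature `principalStrictTransform` / `completeTransformList` (CJS LNM 2270 Def. 5.5/5.7, `…PrincipalStrictTransform`); this seat's ℓ-glue
(`pointStepOfRecord`, `IsShortestFirstCentre.sncLength_preimage_lt`, `sncLength_preimage_of_iso`); Literature `IsBlowup.exists_eq_of_not_mem_support`,
`comap_vanishingIdeal_image_of_isClosedImmersion`, `blowup.isBlowup`. NOTHING here is a statement of H. Hironaka's manuscript [Hironaka2017] nor of
[CossartJannsenSaito2020]; no named fact is introduced. AI-written; AI review is weaker than expert review.

THE ARGUMENT (support level, general stage — no regularity of `W` or of the members). Square `j ≫ π = ρ ≫ ι` with `ι : D̃ ↪ W` the reduced surface, `π` a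
blow-up of the reduced point `C = 𝓘(ι q)`, `ρ` a blow-up of `D̃` at `C|_D̃ = 𝓘(q)`, `j` the comparison closed immersion. A transformed member `B′` of `B` with
`supp B′ ⊆ π⁻¹ supp B` and `x′ ∈ supp B′ ↔ π x′ ∈ supp B` off `π⁻¹(ι q)` has: (i) `D̃′ ⊆ supp B′ ↔ D̃ ⊆ supp B` (density of `D̃ ∖ {q}` in the integral
surface and of `D̃′ ∖ ρ⁻¹ q` in its blow-up) — so the FILTER «member does not contain the surface» keeps the same members; (ii) `ρ⁻¹(supp Γ ∖ {q}) ⊆ supp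
(B′|_{D̃′}) ⊆ ρ⁻¹ supp Γ` for the trace `Γ = B|_D̃`; (iii) the exceptional member `𝓘(F) = π^* C` is kept and restricts to `ρ^* 𝓘(q)`, support `ρ⁻¹ q`.
Hence `⋃ traces′ = ρ⁻¹(S ∖ {q}) ∪ ρ⁻¹ q ∪ (⊆ ρ⁻¹ S) = ρ⁻¹ S` because `q ∈ S` (the F-75 point step blows up points OF the configuration, locus `T = S`).

## Contents (namespace `…Theorems.SigmaMaxModificationsCorridor3.Sigma`)

* §1 `IsSupportTransform π C B B′` (the support sandwich), `IsBoundaryTransform π C E E′` (members of `E′` = exceptional `C.comap π` + a support transform of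
  each member of `E`); instances **`isBoundaryTransform_next`** (the run: `E.next C`, `π = blowup.π C`) and **`isBoundaryTransform_completeTransformList`**
  (CJS principal transforms, any blow-up `π`).
* §2 THE CORE `divisorSet_restrictOff_eq_preimage` — along the square, for a boundary transform, a reduced-point centre `q` on the configuration, `D̃ ∖ {q}`
  dense with liftable points and `D̃′ ∖ ρ⁻¹ q` dense: `(E′.restrictOff j).divisorSet = ρ⁻¹ (E.restrictOff ι).divisorSet`.
* §3 ON THE NEXT REDUCED SURFACE: `preimage_surfaceTraceSet_surfaceNext` (through 067's iso `e : D̃_ρ ≅ (menuCentre (surfaceNext π C D)).subscheme`: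
  `e ⁻¹ S(E′, surfaceNext π C D) = (E′.restrictOff j).divisorSet`), `comap_subschemeι_vanishingIdeal_singleton` (`𝓘(ι q)|_D̃ = 𝓘(q)`).
* §4 **`surfaceSncLength_next_lt_of_pointStepOfRecord`**: `pointStepOfRecord W hW N ν L P E D C → IsIrreducible D →
  surfaceSncLength (E.next C) (surfaceNext (blowup.π C) C D) < surfaceSncLength E D` — THE ℓ-COORDINATE OF PHASE B′'s `lex(ℓ, M)` DROPS AT EVERY POINT STEP OF
  THE RUN (no hypothesis beyond the step and the irreducibility of `D`; `blowup C` is locally Noetherian by properness) (and resolving compositions of the next configuration exist: `exists_existsPointCompositionN_next_of_pointStepOfRecord`).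

VACUITY SELF-CHECK. §4's premise `pointStepOfRecord …` is inhabited exactly when `0 < ℓ(E, D)` (p544431 `exists_pointStepOfRecord_iff_pos`; under F-75c whenever
the configuration of a regular excellent 2-dimensional surface is nowhere dense and not snc, p545860); `IsIrreducible D` holds for every surface component of
`X(ν)` (`surfaceComponents ⊆ componentsIn`). The conclusion is a strict inequality of natural numbers — not vacuous.
-/

noncomputable section

set_option linter.dupNamespace false -- mandated namespace of this single-conjunct summit

open CategoryTheory AlgebraicGeometry TopologicalSpace
open Summit.ResolutionOfSingularities.ResolutionOfSingularities.Theorems.CampaignW42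
open Literature.AlgebraicGeometry.Resolution Literature.RingTheory.HilbertSamuel

namespace Summit.ResolutionOfSingularities.ResolutionOfSingularities.Theorems.SigmaMaxModificationsCorridor3.Sigma

universe u

open Scheme.IdealSheafData

/-! ## §1. Support transforms of members and of boundaries -/

section Transform

variable {W W' : Scheme.{u}}

/-- [OURS · L1 W4.2] **THE SUPPORT SANDWICH of a transformed member**: `B′` lies over `B` (`supp B′ ⊆ π⁻¹ supp B`) and agrees with the total transform off
the centre (`x′ ∈ supp B′ ↔ π x′ ∈ supp B` for `π x′ ∉ supp C`). Satisfied by the saturated strict transform, the principal strict transform and every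
controlled transform. NOT a statement of the manuscript. [folklore] -/
def IsSupportTransform (π : W' ⟶ W) (C B : W.IdealSheafData) (B' : W'.IdealSheafData) : Prop :=
  ((B'.support : Set W') ⊆ π.base ⁻¹' (B.support : Set W)) ∧
    ∀ x' : W', π.base x' ∉ (C.support : Set W) → (x' ∈ (B'.support : Set W') ↔ π.base x' ∈ (B.support : Set W))

/-- [OURS · L1 W4.2] **`E′` IS A (support-level) TRANSFORM OF THE BOUNDARY `E` under the blow-up `π` of `C`**: every member of `E` has a support transform in
`E′`, every member of `E′` is the exceptional divisor `π^* C` or a support transform of a member of `E`, and the exceptional divisor is a member of `E′`. NOT a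
statement of the manuscript. [folklore] -/
def IsBoundaryTransform (π : W' ⟶ W) (C : W.IdealSheafData) (E : Boundary W) (E' : Boundary W') : Prop :=
  (∀ B ∈ E, ∃ B' ∈ E', IsSupportTransform π C B B') ∧ (∀ B' ∈ E', B' = C.comap π ∨ ∃ B ∈ E, IsSupportTransform π C B B') ∧ C.comap π ∈ E'

/-- **The saturated strict transform is a support transform** (support below the principal strict transform, hence over `supp B`; total transform off the
centre — res-L1-type-o1's `Sigma.mem_support_strictTransformIdeal_iff_of_not_mem`). [folklore] -/
theorem isSupportTransform_strictTransformIdeal [IsLocallyNoetherian W] (C B : W.IdealSheafData) [IsLocallyNoetherian (blowup C)] :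
    IsSupportTransform (blowup.π C) C B (strictTransformIdeal (blowup.π C) C B) :=
  ⟨(support_strictTransformIdeal_subset_support_principalStrictTransform (π := blowup.π C) (C := C) B).trans
      (support_principalStrictTransform_subset (π := blowup.π C) (C := C) B),
    fun _ hx' => mem_support_strictTransformIdeal_iff_of_not_mem C B hx'⟩

/-- **The principal strict transform is a support transform** (Literature `support_principalStrictTransform_subset`,
`mem_support_principalStrictTransform_iff_of_not_mem`). [cite: CossartJannsenSaito2020, Rem. 5.6 (a) (LNM 2270)] -/
theorem isSupportTransform_principalStrictTransform [IsLocallyNoetherian W] [IsLocallyNoetherian W'] {π : W' ⟶ W} {C : W.IdealSheafData}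
    (hπ : IsBlowup π C) (B : W.IdealSheafData) : IsSupportTransform π C B (principalStrictTransform π C B) :=
  ⟨support_principalStrictTransform_subset B, fun _ hx' => mem_support_principalStrictTransform_iff_of_not_mem hπ B hx'⟩

/-- **THE RUN'S `Boundary.next` IS A BOUNDARY TRANSFORM** (saturated strict transforms of the members, then the exceptional divisor). [folklore] -/
theorem isBoundaryTransform_next [IsLocallyNoetherian W] (E : Boundary W) (C : W.IdealSheafData) [IsLocallyNoetherian (blowup C)] :
    IsBoundaryTransform (blowup.π C) C E (E.next C) := by
  refine ⟨fun B hB => ?_, fun B' hB' => ?_, ?_⟩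
  · exact ⟨strictTransformIdeal (blowup.π C) C B, List.mem_append.mpr (Or.inl (List.mem_map.mpr ⟨B, hB, rfl⟩)),
      isSupportTransform_strictTransformIdeal C B⟩
  · simp only [Boundary.next, List.mem_append, List.mem_map, List.mem_singleton] at hB'
    rcases hB' with ⟨B, hB, rfl⟩ | rfl
    · exact Or.inr ⟨B, hB, isSupportTransform_strictTransformIdeal C B⟩
    · exact Or.inl rfl
  · simp [Boundary.next]

/-- **CJS's `completeTransformList` IS A BOUNDARY TRANSFORM** (principal strict transforms of the members, then the exceptional divisor), for any blow-up `π`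
of `C`. [cite: CossartJannsenSaito2020, Def. 5.7 (LNM 2270)] -/
theorem isBoundaryTransform_completeTransformList [IsLocallyNoetherian W] [IsLocallyNoetherian W'] {π : W' ⟶ W} {C : W.IdealSheafData}
    (hπ : IsBlowup π C) (E : Boundary W) : IsBoundaryTransform π C E (completeTransformList π C E) := by
  refine ⟨fun B hB => ?_, fun B' hB' => ?_, ?_⟩
  · exact ⟨principalStrictTransform π C B, List.mem_append.mpr (Or.inl (List.mem_map.mpr ⟨B, hB, rfl⟩)),
      isSupportTransform_principalStrictTransform hπ B⟩
  · simp only [completeTransformList, List.mem_append, List.mem_map, List.mem_singleton] at hB'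
    rcases hB' with ⟨B, hB, rfl⟩ | rfl
    · exact Or.inr ⟨B, hB, isSupportTransform_principalStrictTransform hπ B⟩
    · exact Or.inl rfl
  · simp [completeTransformList]

end Transform

/-! ## §2. The core: traces of a boundary transform along the comparison square -/

section Core

variable {W W' D DZ : Scheme.{u}} {ι : D ⟶ W} {π : W' ⟶ W} {ρ : DZ ⟶ D} {j : DZ ⟶ W'} {C : W.IdealSheafData} {q : D}

/-- Along the square, `π (j z) = ι (ρ z)`. [folklore] -/
theorem apply_comparison_eq (hsq : j ≫ π = ρ ≫ ι) (z : DZ) : π.base (j.base z) = ι.base (ρ.base z) := by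
  have h := congrArg (fun f : DZ ⟶ W => f.base z) hsq
  simpa only [Scheme.Hom.comp_base, TopCat.coe_comp, Function.comp_apply] using h

/-- A dense subset of a closed set forces the closed set to be everything. [folklore] -/
theorem eq_univ_of_dense_subset {X : Type*} [TopologicalSpace X] {s A : Set X} (hs : Dense s) (hA : IsClosed A) (h : s ⊆ A) : A = Set.univ := by
  have h1 : closure s ⊆ A := hA.closure_subset_iff.mpr h
  rw [hs.closure_eq] at h1
  exact Set.eq_univ_of_univ_subset h1

/-- **(i) A SUPPORT TRANSFORM CONTAINS THE BLOWN-UP SURFACE IFF THE MEMBER CONTAINS THE SURFACE** — so the filter «member does not contain the surface» selects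
the same members before and after. Uses: points of `D̃ ∖ {q}` lift along `ρ`, `D̃ ∖ {q}` is dense in `D̃`, `D̃′ ∖ ρ⁻¹ q` is dense in `D̃′`, `ι` injective,
`supp C = {ι q}`. [folklore] -/
theorem range_subset_support_iff_of_isSupportTransform [IsClosedImmersion ι] (hsq : j ≫ π = ρ ≫ ι) (hC : (C.support : Set W) = {ι.base q})
    (hlift : ∀ y : D, y ≠ q → ∃ z : DZ, ρ.base z = y) (hDd : Dense ({q}ᶜ : Set D)) (hZd : Dense ((ρ.base ⁻¹' {q})ᶜ : Set DZ))
    {B : W.IdealSheafData} {B' : W'.IdealSheafData} (hB : IsSupportTransform π C B B') :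
    Set.range j.base ⊆ (B'.support : Set W') ↔ Set.range ι.base ⊆ (B.support : Set W) := by
  constructor
  · intro h
    -- `{y | ι y ∈ supp B}` is closed and contains `D̃ ∖ {q}`
    have hA : IsClosed {y : D | ι.base y ∈ (B.support : Set W)} := B.support.isClosed.preimage ι.continuous
    have hsub : ({q}ᶜ : Set D) ⊆ {y : D | ι.base y ∈ (B.support : Set W)} := by
      intro y hy
      obtain ⟨z, hz⟩ := hlift y hy
      have h1 : j.base z ∈ (B'.support : Set W') := h ⟨z, rfl⟩
      have h2 := hB.1 h1
      rw [Set.mem_preimage, apply_comparison_eq hsq, hz] at h2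
      exact h2
    have hAu := eq_univ_of_dense_subset hDd hA hsub
    rintro _ ⟨y, rfl⟩
    have hy : y ∈ {y : D | ι.base y ∈ (B.support : Set W)} := hAu ▸ Set.mem_univ y
    exact hy
  · intro h
    have hA : IsClosed {z : DZ | j.base z ∈ (B'.support : Set W')} := B'.support.isClosed.preimage j.continuous
    have hsub : ((ρ.base ⁻¹' {q})ᶜ : Set DZ) ⊆ {z : DZ | j.base z ∈ (B'.support : Set W')} := by
      intro z hz
      have hzq : ρ.base z ≠ q := fun h' => hz h'
      have hnot : π.base (j.base z) ∉ (C.support : Set W) := by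
        rw [hC, apply_comparison_eq hsq, Set.mem_singleton_iff]
        exact fun h' => hzq (ι.isClosedEmbedding.injective h')
      change j.base z ∈ (B'.support : Set W')
      rw [hB.2 _ hnot, apply_comparison_eq hsq]
      exact h ⟨ρ.base z, rfl⟩
    have hAu := eq_univ_of_dense_subset hZd hA hsub
    rintro _ ⟨z, rfl⟩
    have hz : z ∈ {z : DZ | j.base z ∈ (B'.support : Set W')} := hAu ▸ Set.mem_univ z
    exact hz

/-- **(iii) THE EXCEPTIONAL MEMBER DOES NOT CONTAIN THE BLOWN-UP SURFACE** (else `D̃ ∖ {q}` would be empty). [folklore] -/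
theorem not_range_subset_support_exceptional [IsClosedImmersion ι] (hsq : j ≫ π = ρ ≫ ι) (hC : (C.support : Set W) = {ι.base q})
    (hlift : ∀ y : D, y ≠ q → ∃ z : DZ, ρ.base z = y) (hDd : Dense ({q}ᶜ : Set D)) :
    ¬ Set.range j.base ⊆ ((C.comap π).support : Set W') := by
  haveI : Nonempty D := ⟨q⟩
  intro h
  obtain ⟨y, hy⟩ := hDd.nonempty
  obtain ⟨z, hz⟩ := hlift y hy
  have h1 := h ⟨z, rfl⟩
  rw [Boundary.coe_support_comap, Set.mem_preimage, hC, apply_comparison_eq hsq, hz, Set.mem_singleton_iff] at h1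
  exact hy (ι.isClosedEmbedding.injective h1)

/-- **THE CORE — the filtered trace configuration of a boundary transform is the total transform of the filtered trace configuration**: along the square
`j ≫ π = ρ ≫ ι`, for `E′` a boundary transform of `E` under the blow-up of the reduced point `ι q` with `q` ON the configuration,
`(E′.restrictOff j).divisorSet = ρ⁻¹ (E.restrictOff ι).divisorSet`. General stage. [folklore] -/
theorem divisorSet_restrictOff_eq_preimage [IsClosedImmersion ι] (hsq : j ≫ π = ρ ≫ ι) (hC : (C.support : Set W) = {ι.base q})
    (hlift : ∀ y : D, y ≠ q → ∃ z : DZ, ρ.base z = y) (hDd : Dense ({q}ᶜ : Set D)) (hZd : Dense ((ρ.base ⁻¹' {q})ᶜ : Set DZ))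
    {E : Boundary W} {E' : Boundary W'} (hE : IsBoundaryTransform π C E E') (hq : q ∈ (E.restrictOff ι).divisorSet) :
    (E'.restrictOff j).divisorSet = ρ.base ⁻¹' (E.restrictOff ι).divisorSet := by
  -- the member of `E` carrying `q`
  obtain ⟨Jq, hJq, hqJ⟩ := Boundary.mem_divisorSet_iff.mp hq
  obtain ⟨Bq, hBqE, hBqD, rfl⟩ := Boundary.mem_restrictOff_iff.mp hJq
  ext x
  rw [Set.mem_preimage, Boundary.mem_divisorSet_iff, Boundary.mem_divisorSet_iff]
  constructor
  · rintro ⟨J', hJ', hxJ'⟩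
    obtain ⟨B', hB'E, hB'D, rfl⟩ := Boundary.mem_restrictOff_iff.mp hJ'
    rw [Boundary.coe_support_comap, Set.mem_preimage] at hxJ'
    rcases hE.2.1 B' hB'E with rfl | ⟨B, hBE, hBB'⟩
    · -- the exceptional member: `ρ x = q`, and `q` lies on the trace `Bq|_D̃`
      rw [Boundary.coe_support_comap, Set.mem_preimage, hC, apply_comparison_eq hsq, Set.mem_singleton_iff] at hxJ'
      have hx : ρ.base x = q := ι.isClosedEmbedding.injective hxJ'
      exact ⟨Bq.comap ι, Boundary.mem_restrictOff_iff.mpr ⟨Bq, hBqE, hBqD, rfl⟩, by rw [hx]; exact hqJ⟩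
    · -- a transformed member: kept iff kept, and it lies over its member
      have hBD : ¬ Set.range ι.base ⊆ (B.support : Set W) :=
        fun h => hB'D ((range_subset_support_iff_of_isSupportTransform hsq hC hlift hDd hZd hBB').mpr h)
      refine ⟨B.comap ι, Boundary.mem_restrictOff_iff.mpr ⟨B, hBE, hBD, rfl⟩, ?_⟩
      rw [Boundary.coe_support_comap, Set.mem_preimage, ← apply_comparison_eq hsq]
      exact hBB'.1 hxJ'
  · rintro ⟨J, hJ, hxJ⟩
    obtain ⟨B, hBE, hBD, rfl⟩ := Boundary.mem_restrictOff_iff.mp hJ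
    rw [Boundary.coe_support_comap, Set.mem_preimage] at hxJ
    by_cases hx : ρ.base x = q
    · -- over `q`: the exceptional member
      refine ⟨(C.comap π).comap j, Boundary.mem_restrictOff_iff.mpr ⟨C.comap π, hE.2.2, not_range_subset_support_exceptional hsq hC hlift hDd, rfl⟩, ?_⟩
      rw [Boundary.coe_support_comap, Set.mem_preimage, Boundary.coe_support_comap, Set.mem_preimage, hC, apply_comparison_eq hsq, hx]
      exact Set.mem_singleton _
    · -- off `q`: the transform of `B`
      obtain ⟨B', hB'E, hBB'⟩ := hE.1 B hBE
      have hB'D : ¬ Set.range j.base ⊆ (B'.support : Set W') :=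
        fun h => hBD ((range_subset_support_iff_of_isSupportTransform hsq hC hlift hDd hZd hBB').mp h)
      refine ⟨B'.comap j, Boundary.mem_restrictOff_iff.mpr ⟨B', hB'E, hB'D, rfl⟩, ?_⟩
      have hnot : π.base (j.base x) ∉ (C.support : Set W) := by
        rw [hC, apply_comparison_eq hsq, Set.mem_singleton_iff]
        exact fun h' => hx (ι.isClosedEmbedding.injective h')
      rw [Boundary.coe_support_comap, Set.mem_preimage, hBB'.2 _ hnot, apply_comparison_eq hsq]
      exact hxJ

end Core

/-! ## §3. Reading on the next reduced surface -/

section Surface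

variable {W W' : Scheme.{u}} {π : W' ⟶ W} {C : W.IdealSheafData}

/-- **The configuration of the next surface, read on the blow-up of the surface**: through res-type-067's isomorphism
`e : D̃_ρ ≅ (menuCentre (surfaceNext π C D)).subscheme` over the comparison morphism, `e⁻¹ S(E′, surfaceNext π C D) = (E′.restrictOff j).divisorSet`.
TRANSFORM-AGNOSTIC (`E′` any boundary of the next stage). [folklore] -/
theorem preimage_surfaceTraceSet_surfaceNext (hπ : IsBlowup π C) {D : Closeds W} {DZ : Scheme.{u}} {ρ : DZ ⟶ (menuCentre D).subscheme}
    (hρ : IsBlowup ρ (C.comap (menuCentre D).subschemeι)) (e : DZ ≅ (menuCentre (surfaceNext π C D)).subscheme)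
    (he : e.hom ≫ (menuCentre (surfaceNext π C D)).subschemeι = hπ.strictTransformHom hρ) (E' : Boundary W') :
    e.hom.base ⁻¹' surfaceTraceSet E' (surfaceNext π C D) = (E'.restrictOff (hπ.strictTransformHom hρ)).divisorSet := by
  rw [surfaceTraceSet_eq, ← Boundary.divisorSet_restrict, ← he, ← Boundary.restrictOff_map_comap E' _ e.hom]
  rfl

/-- **The reduced point of `W` restricts to the reduced point of the surface**: `𝓘(ι q)|_D̃ = 𝓘(q)` (Literature `comap_vanishingIdeal_image_of_isClosedImmersion`).
[folklore] -/
theorem comap_subschemeι_vanishingIdeal_singleton {D : Scheme.{u}} (ι : D ⟶ W) [IsClosedImmersion ι] {q : D} (hq : IsClosed ({q} : Set D))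
    (hqW : IsClosed ({ι.base q} : Set W)) :
    (vanishingIdeal (⟨{ι.base q}, hqW⟩ : Closeds W)).comap ι = vanishingIdeal ⟨{q}, hq⟩ := by
  have h := comap_vanishingIdeal_image_of_isClosedImmersion ι ⟨{q}, hq⟩
  have hZ : (⟨ι '' ((⟨{q}, hq⟩ : Closeds D) : Set D), ι.isClosedEmbedding.isClosedMap _ (⟨{q}, hq⟩ : Closeds D).2⟩ : Closeds W) =
      ⟨{ι.base q}, hqW⟩ :=
    Closeds.ext (by simp only [Closeds.coe_mk, Set.image_singleton])
  rw [hZ] at h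
  exact h

end Surface

/-! ## §4. The run-level ℓ-drop at a point step -/

section Run

variable {W : Scheme.{u}} {hW : IsLocallyNoetherian W} {N : ℕ} {ν : ℕ → ℕ} {L : Labelling W} {P : Option (Pending W)}
  {E : Boundary W} {D : Closeds W} {C : W.IdealSheafData}

/-- **THE IDENTIFICATION AT A POINT STEP OF THE RUN.** If the F-75 point step proposed `C` for the irreducible surface `D`, then `C = 𝓘(ι q)` for a closed point
`q ∈ S(E, D)` of the integral reduced surface `D̃`, and for `ρ : D̃_ρ → D̃` the chosen blow-up of `D̃` at `q` and res-type-067's isomorphism `e` onto the reduced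
next surface: `e⁻¹ S(E.next C, surfaceNext (blowup.π C) C D) = ρ⁻¹ S(E, D)`. [folklore] -/
theorem exists_preimage_surfaceTraceSet_next_eq_of_pointStepOfRecord (hstep : pointStepOfRecord W hW N ν L P E D C) (hDirr : IsIrreducible (D : Set W)) :
    ∃ (q : ↥(menuCentre D).subscheme) (hq : IsClosed ({q} : Set ↥(menuCentre D).subscheme)),
      IsShortestFirstCentre (surfaceTraceSet E D) (ResolvesToSnc (surfaceTraceSet E D)) q ∧
      IsBlowup (blowup.π (C.comap (menuCentre D).subschemeι)) (vanishingIdeal ⟨{q}, hq⟩) ∧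
      ∃ e : blowup (C.comap (menuCentre D).subschemeι) ≅ (menuCentre (surfaceNext (blowup.π C) C D)).subscheme,
        e.hom.base ⁻¹' surfaceTraceSet (E.next C) (surfaceNext (blowup.π C) C D) =
          (blowup.π (C.comap (menuCentre D).subschemeι)).base ⁻¹' surfaceTraceSet E D := by
  haveI := hW
  haveI : IsProper (blowup.π C) := (blowup.isBlowup C).isProper
  haveI : IsLocallyNoetherian (blowup C) := LocallyOfFiniteType.isLocallyNoetherian (blowup.π C)
  obtain ⟨q, hqW, hfirst, rfl⟩ := hstep
  set ι := (menuCentre D).subschemeι with hι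
  have hq : IsClosed ({q} : Set ↥(menuCentre D).subscheme) := hfirst.isClosed
  have hne : ({q} : Set ↥(menuCentre D).subscheme) ≠ Set.univ := hfirst.ne_univ
  -- the centre restricted to the surface is the reduced point `q`
  have hCι : (vanishingIdeal (⟨{ι.base q}, hqW⟩ : Closeds W)).comap ι = vanishingIdeal ⟨{q}, hq⟩ :=
    comap_subschemeι_vanishingIdeal_singleton ι hq hqW
  have hC : ((vanishingIdeal (⟨{ι.base q}, hqW⟩ : Closeds W)).support : Set W) = {ι.base q} := Scheme.IdealSheafData.coe_support_vanishingIdeal _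
  -- the two blow-ups and the comparison
  have hπ := blowup.isBlowup (vanishingIdeal (⟨{ι.base q}, hqW⟩ : Closeds W))
  have hρ := blowup.isBlowup ((vanishingIdeal (⟨{ι.base q}, hqW⟩ : Closeds W)).comap ι)
  have hρ' : IsBlowup (blowup.π ((vanishingIdeal (⟨{ι.base q}, hqW⟩ : Closeds W)).comap ι)) (vanishingIdeal ⟨{q}, hq⟩) := by
    rw [← hCι]; exact hρ
  set ρ := blowup.π ((vanishingIdeal (⟨{ι.base q}, hqW⟩ : Closeds W)).comap ι) with hρdef
  -- integrality of the surface and of its blow-up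
  haveI : IsIntegral (menuCentre D).subscheme := isIntegral_subscheme_vanishingIdeal D hDirr
  haveI : IsIntegral (blowup ((vanishingIdeal (⟨{ι.base q}, hqW⟩ : Closeds W)).comap ι)) :=
    hρ'.isIntegral (vanishingIdeal_singleton_ne_bot hq hne)
  obtain ⟨e, he⟩ := exists_iso_menuCentre_surfaceNext hπ hρ
  refine ⟨q, hq, hfirst, hρ', e, ?_⟩
  -- side conditions of the core
  have hlift : ∀ y : ↥(menuCentre D).subscheme, y ≠ q → ∃ z, ρ.base z = y := by
    intro y hy
    refine hρ'.exists_eq_of_not_mem_support ?_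
    rw [Scheme.IdealSheafData.coe_support_vanishingIdeal]
    exact hy
  have hDd : Dense ({q}ᶜ : Set ↥(menuCentre D).subscheme) := by
    refine hq.isOpen_compl.dense ?_
    rw [Set.nonempty_compl]
    exact hne
  have hZd : Dense ((ρ.base ⁻¹' {q})ᶜ : Set ↥(blowup ((vanishingIdeal (⟨{ι.base q}, hqW⟩ : Closeds W)).comap ι))) := by
    refine (hq.preimage ρ.continuous).isOpen_compl.dense ?_
    haveI : Nonempty ↥(menuCentre D).subscheme := ⟨q⟩
    obtain ⟨y, hy⟩ := hDd.nonempty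
    obtain ⟨z, hz⟩ := hlift y hy
    exact ⟨z, fun h => hy (by rw [Set.mem_preimage, hz, Set.mem_singleton_iff] at h; exact h)⟩
  rw [preimage_surfaceTraceSet_surfaceNext hπ hρ e he, surfaceTraceSet_eq]
  exact divisorSet_restrictOff_eq_preimage (hπ.strictTransformHom_comp hρ) hC hlift hDd hZd
    (isBoundaryTransform_next E _) hfirst.mem

/-- **THE ℓ-COORDINATE DROPS AT EVERY POINT STEP OF THE RUN.** If the F-75 point step proposed the centre `C` for the irreducible surface component `D` at the
state `(W, L, P, E)`, then on the next state — boundary `E.next C`, surface `surfaceNext (blowup.π C) C D` — the least resolving length is smaller: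
`ℓ(E.next C, D′) < ℓ(E, D)`. (PHASE B′'s `lex(ℓ, M)` first coordinate; with `sncLength_preimage_of_isIso` for cure steps.) [folklore] -/
theorem surfaceSncLength_next_lt_of_pointStepOfRecord (hstep : pointStepOfRecord W hW N ν L P E D C) (hDirr : IsIrreducible (D : Set W)) :
    surfaceSncLength (E.next C) (surfaceNext (blowup.π C) C D) < surfaceSncLength E D := by
  obtain ⟨q, hq, hfirst, hρ, e, hS⟩ := exists_preimage_surfaceTraceSet_next_eq_of_pointStepOfRecord hstep hDirr
  rw [surfaceSncLength_eq (E.next C), ← sncLength_preimage_of_iso e, hS]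
  exact (hfirst.sncLength_preimage_lt _ hρ).2

/-- … and resolving compositions of the next configuration (with centres on it) EXIST, so `ℓ` stays meaningful along the run without re-invoking F-75c.
[folklore] -/
theorem exists_existsPointCompositionN_next_of_pointStepOfRecord (hstep : pointStepOfRecord W hW N ν L P E D C) (hDirr : IsIrreducible (D : Set W)) :
    ∃ n, ExistsPointCompositionN (surfaceTraceSet (E.next C) (surfaceNext (blowup.π C) C D))
      (ResolvesToSnc (surfaceTraceSet (E.next C) (surfaceNext (blowup.π C) C D))) n := by
  obtain ⟨q, hq, hfirst, hρ, e, hS⟩ := exists_preimage_surfaceTraceSet_next_eq_of_pointStepOfRecord hstep hDirr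
  obtain ⟨⟨n, hn⟩, -⟩ := hfirst.sncLength_preimage_lt _ hρ
  rw [← hS] at hn
  -- transport along `e` (base iso) back to the reduced next surface
  have h := ExistsPointCompositionN.transport_iff (T := surfaceTraceSet (E.next C) (surfaceNext (blowup.π C) C D))
    (P := ResolvesToSnc (surfaceTraceSet (E.next C) (surfaceNext (blowup.π C) C D)))
    (ResolvesToSnc.isoStable (surfaceTraceSet (E.next C) (surfaceNext (blowup.π C) C D))) e.symm (n := n)
  rw [Iso.symm_inv, ResolvesToSnc.restrict_eq] at h
  exact ⟨n, h.mp hn⟩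

end Run

end Summit.ResolutionOfSingularities.ResolutionOfSingularities.Theorems.SigmaMaxModificationsCorridor3.Sigma

end
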